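import Mathlib
import HarnessLib
import Literature.MathematicalPhysics.QuantumFieldTheory.ConstructiveQFTWave0Proofs
import Literature.MathematicalPhysics.QuantumFieldTheory.ConstructiveQFTWave0SiteRPProofs
import Literature.MathematicalPhysics.QuantumFieldTheory.LatticeSiteRPMechanism

/-!
# Crux `FemtoCurvatureTwoPoint` (stmt-QuantumFields-9363, route `LangevinControlUV`):
# strict positivity of the axis covariance — definitions

Route-internal vocabulary (D-0016 `Defs` file, reviewed) of the strict transfer-matrix positivity
argument for the registered sub-goal `stub_axisPositive` (`--supports stmt-QuantumFields-9363`); the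
theorems live in the companion files `…StrictRP{GramStrict,SWVanish,SliceKernel,SliceLemma,
SiteGeometry,SiteTransfer,SiteTransferForm,SiteStrict}`. Nothing here is asserted.

* Slice objects (any group, any set of links `E` of the torus `(ℤ/L)^d`): the real Frobenius pairing
  `pairing ρ g h = Re tr(ρ(g) ρ(h)ᴴ)`, the **slice Gram kernel**
  `sliceKernel ρ β E A W = exp(β ∑_{e ∈ E} ⟪ρ(A_e), ρ(W_e)⟫)` (one transfer step of Wilson's theory in
  temporal gauge is a gauge average of such kernels), its Gram feature index `FeatIndex` and features
  `feature` (`√β · Re/Im ρ(W_e)_{ab}`).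
* Site-reflection objects on the even torus (reflection `θ' t = −t`, positive half `0 ≤ t ≤ L/2`,
  tree `ConstructiveQFTWave0SiteRPProofs`): the spatial links of the slice `t = 1`
  (`sliceOneEdges`), the temporal links `0 → 1` (`lowEdges`), the bottom spatial links
  (`bottomEdges`), the temporal plaquettes based at `t = 0` (`IsLowPlaq`: the lowest transfer step,
  `lowAction`) and the rest of the site-positive action (`restAction`), the gauge function `gaugeOf Y`
  supported on the slice `t = 1`, the doubly resampled configuration `lowSplice`, the boundary shift
  `shiftDown`, the rest weight `restWeight`, the real slab functional `chiR` and the boundary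
  configurations `bottomConfig`.
-/

set_option autoImplicit false

noncomputable section

namespace Summit.QuantumFields.YangMills.Theorems.FemtoCurvatureTwoPoint.StrictRP

open MeasureTheory Finset
open scoped Matrix ComplexConjugate
open Literature.MathematicalPhysics.QuantumFieldTheory

section SliceDefs

variable {d L N : ℕ} {G : Type*} [Group G] (ρ : G →* Matrix (Fin N) (Fin N) ℂ)

/-- The real Frobenius pairing `Re tr(ρ(g) ρ(h)ᴴ)` of two represented group elements. -/
def pairing (g h : G) : ℝ := (ρ g * (ρ h)ᴴ).trace.re

/-- The slice Gram kernel `exp(β ∑_{e ∈ E} ⟪ρ(A_e), ρ(W_e)⟫)` of a set of links `E`. -/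
def sliceKernel (β : ℝ) (E : Finset (Edge d L)) (A W : GaugeConfig d L G) : ℝ :=
  Real.exp (β * ∑ e ∈ E, pairing ρ (A e) (W e))

/-- Feature index of a slice: link, matrix entry, real/imaginary part. -/
abbrev FeatIndex (E : Finset (Edge d L)) (N : ℕ) : Type := ↥E × Fin N × Fin N × Bool

/-- The features `√β · Re/Im ρ(W_e)_{ab}`. -/
def feature (β : ℝ) {E : Finset (Edge d L)} (i : FeatIndex E N) (W : GaugeConfig d L G) : ℝ :=
  Real.sqrt β * (if i.2.2.2 then (ρ (W i.1) i.2.1 i.2.2.1).re else (ρ (W i.1) i.2.1 i.2.2.1).im)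

/-- The slice kernel of the empty set of links is `1`. -/
theorem sliceKernel_empty (β : ℝ) (A W : GaugeConfig d L G) :
    sliceKernel ρ β (∅ : Finset (Edge d L)) A W = 1 := by
  simp [sliceKernel]

end SliceDefs

section SiteDefs

variable {d L N : ℕ} [NeZero d] [NeZero L] {G : Type*} [Group G] (ρ : G →* Matrix (Fin N) (Fin N) ℂ)

/-- Spatial links of the time slice `t = 1`. -/
def sliceOneEdges : Finset (Edge d L) := univ.filter fun e => e.2 ≠ 0 ∧ (e.1 0).val = 1

/-- Temporal links `0 → 1`. -/
def lowEdges : Finset (Edge d L) := univ.filter fun e => e.2 = 0 ∧ (e.1 0).val = 0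

/-- Spatial links of the time slice `t = 0` (the lower reflection hyperplane). -/
def bottomEdges : Finset (Edge d L) := univ.filter fun e => e.2 ≠ 0 ∧ (e.1 0).val = 0

/-- Temporal plaquettes based in the slice `t = 0` (the lowest transfer step). -/
def IsLowPlaq (p : Plaquette d L) : Prop := p.2.1.1 = 0 ∧ (p.1 0).val = 0

/-- `IsLowPlaq` is decidable. -/
instance : DecidablePred (IsLowPlaq (d := d) (L := L)) := fun _ => by
  unfold IsLowPlaq; infer_instance

/-- The gauge function built from the temporal links `0 → 1` of `Y`, supported on the slice
`t = 1`: `γ_Y(x) = Y(x − e₀, 0)` for `x` at time `1`, and `1` elsewhere. -/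
def gaugeOf (Y : GaugeConfig d L G) (x : Site d L) : G :=
  if (x 0).val = 1 then Y (x - Pi.single 0 1, 0) else 1

variable [TopologicalSpace G] [IsTopologicalGroup G] [CompactSpace G] [MeasurableSpace G] [BorelSpace G]

/-- The lowest transfer step: the temporal plaquettes based in the slice `t = 0`. -/
def lowAction (U : GaugeConfig d L G) : ℝ := ∑ p ∈ univ.filter IsLowPlaq, WilsonRP.plaqRe ρ U p

/-- The remaining site-positive plaquettes. -/
def restAction (U : GaugeConfig d L G) : ℝ :=
  ∑ p ∈ (univ.filter WilsonSiteRP.IsSitePosPlaq).filter (fun p => ¬ IsLowPlaq p), WilsonRP.plaqRe ρ U p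

/-- The configuration feeding the lowest transfer step: site-positive links resampled, the
temporal links `0 → 1` resampled once more. -/
def lowSplice (V W Y : GaugeConfig d L G) : GaugeConfig d L G :=
  LatticeRP.splice WilsonSiteRP.sitePosEdges (V, LatticeRP.splice lowEdges (W, Y))

/-- The boundary slice seen from the slice `t = 1`: `A(x, i) = V(x − e₀, i)`. -/
def shiftDown (V : GaugeConfig d L G) : GaugeConfig d L G := fun e => V (e.1 - Pi.single 0 1, e.2)

/-- The weight of the rest of the positive half: `exp(β · restAction)` on the spliced
configuration with trivial boundary data. -/
def restWeight (β : ℝ) (W : GaugeConfig d L G) : ℝ :=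
  Real.exp (β * restAction ρ (LatticeRP.splice WilsonSiteRP.sitePosEdges ((fun _ => (1 : G)), W)))

/-- The real slab functional of the site reflection for the observable `Re tr ρ(U_q) − m`:
`χ_ℝ(V) = ∫ (Re tr ρ(Z_q) − m) exp(β A'(Z)) dW`, `Z = splice_{P'}(V, W)`. -/
def chiR (β : ℝ) (q : Plaquette d L) (m : ℝ) (V : GaugeConfig d L G) : ℝ :=
  ∫ W, (WilsonRP.plaqRe ρ (LatticeRP.splice WilsonSiteRP.sitePosEdges (V, W)) q - m) *
      Real.exp (β * WilsonSiteRP.sitePosAction ρ (LatticeRP.splice WilsonSiteRP.sitePosEdges (V, W)))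
    ∂(LatticeRP.piMeasure (ι := Edge d L) (haarProbability G))

/-- Boundary data with prescribed bottom slice (read off `A` one step up) and trivial elsewhere. -/
def bottomConfig (A : GaugeConfig d L G) : GaugeConfig d L G :=
  fun e => if e ∈ (bottomEdges : Finset (Edge d L)) then A (e.1.shift 0, e.2) else 1

end SiteDefs

/-- **Registered sub-goal `stub_sliceKernel_empty`** (`--supports stmt-QuantumFields-9363`; anchors this definitions file): the slice kernel of no links is `1`. -/
theorem stub_sliceKernel_empty : ∀ (d L N : ℕ) (G : Type) [Group G] (ρ : G →* Matrix (Fin N) (Fin N) ℂ) (β : ℝ) (A W : Literature.MathematicalPhysics.QuantumFieldTheory.GaugeConfig d L G), Summit.QuantumFields.YangMills.Theorems.FemtoCurvatureTwoPoint.StrictRP.sliceKernel ρ β (∅ : Finset (Literature.MathematicalPhysics.QuantumFieldTheory.Edge d L)) A W = 1 := by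
  intro d L N G _ ρ β A W
  exact sliceKernel_empty ρ β A W

end Summit.QuantumFields.YangMills.Theorems.FemtoCurvatureTwoPoint.StrictRP

end
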